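/-
Copyright: H21 programme, solo seat `solo-RiemannHypothesis-informed` (session 4).
-/
import Summits.RiemannHypothesis.RiemannHypothesis.Theorems.SoloInformedLocalSampling

/-!
# The conditional threshold criterion (solo-informed, T13)

`weilGroundEnergy_le_local_of_oddDipole` (T12) bounds the ground-state defect `ε(a)` of the
window `[-a, a]` in the presence of an off-line zero `ρ₀ = ½ + η + iγ₀` (`0 < |η| < ½`), under
local RH near `γ₀` up to the pair `{ρ₀, ρ₀*}`, by an expression all of whose terms are explicit
norms of the (dodged) test function.  This file records the two readings of that inequality that
constitute the endgame of the window programme: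

* `weilGroundEnergy_neg_of_local_oddDipole` (THRESHOLD FORM): if some odd Weil test `h` in
  `[-a, a]` achieves `2A₁((‖k‖₁² + ‖k′‖₁²) + 2e^{a}‖k⁽ⁿ⁺¹⁾‖₁²/R^{2n}) log(|γ₀|+2) < 2m(ρ₀)(η²+τ²)²|∫ h e^{ηt}|²`
  (`k = D_τ h`), then `ε(a) < 0`;
* `pair_gain_le_of_weilGroundEnergy_nonneg` (EXCLUSION FORM): conversely, Weil positivity at
  window `a` (`ε(a) ≥ 0`) together with local RH near `γ₀` forces, for EVERY such `h, τ, n`,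
  `2m(ρ₀)(η²+τ²)²|∫ h e^{ηt}|² ≤ 2A₁((‖k‖₁² + ‖k′‖₁²) + 2e^{a}‖k⁽ⁿ⁺¹⁾‖₁²/R^{2n}) log(|γ₀|+2)`.

For the family `h_a(t) = sinh(ηt)·b_a(t)` (`b_a` a plateau bump equal to `1` on `[1−a, a−1]`)
one has `∫ h_a e^{ηt} ≥ sinh(2η(a−1))/(2η) − (a−1) ≍ e^{2|η|a}` while every norm on the right is
`O_{η,τ,n}(e^{|η|a})`, so the exclusion form fails as soon as `e^{2|η|a} ≫_{η} log γ₀`: under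
local RH of radius `R ≍ a^{1+o(1)}` an isolated off-line zero of offset `η` is visible from the
DOUBLE-logarithmic window `a ≈ (2|η|)⁻¹ log log γ₀`.  Those three norm estimates are ordinary
real analysis and are the only remaining input; they are not formalised here (paper (D8)).
-/

open MeasureTheory Complex Set Filter Topology Literature.NumberTheory.LFunctions
open scoped ContDiff

namespace Summit.RiemannHypothesis.RiemannHypothesis.Theorems

/-- **Threshold form (T13).** With the absolute `A₁` of `weilGroundEnergy_le_local_of_oddDipole`:
under its hypotheses (odd Weil test `h` in `[-a, a]`, `k = D_τ h ≠ 0`, a zero `½ + η + iγ₀` with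
`0 < |η| < ½`, `γ₀ ≠ 0`, local RH of radius `R ≥ 1` near `γ₀` up to the pair), if the pair gain
beats the local sampling majorant,
`2A₁((‖k‖₁² + ‖k′‖₁²) + 2e^{a}‖k⁽ⁿ⁺¹⁾‖₁²/R^{2n}) log(|γ₀|+2) < 2m(ρ₀)(η²+τ²)²|∫ h e^{ηt}|²`,
then the ground-state defect of the window is negative: `ε(a) < 0`. -/
theorem weilGroundEnergy_neg_of_local_oddDipole :
    ∃ A₁ : ℝ, 0 < A₁ ∧ ∀ (h : ℝ → ℂ) (a τ η γ₀ R : ℝ) (n : ℕ), IsWeilTest h →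
      (∀ t, h (-t) = -h t) → 0 ≤ a → 1 ≤ R → tsupport h ⊆ Icc (-a) a →
      0 < ∫ t, ‖weilDodge τ h t‖ ^ 2 → riemannZeta (1 / 2 + η + γ₀ * I) = 0 → |η| < 1 / 2 →
      η ≠ 0 → γ₀ ≠ 0 →
      (∀ ρ : ℂ, riemannZeta ρ = 0 → 0 ≤ ρ.re → ρ.re ≤ 1 → |ρ.im - γ₀| < R → ρ.re ≠ 1 / 2 →
          ρ = 1 / 2 + η + γ₀ * I ∨ ρ = 1 / 2 - η + γ₀ * I) →
      2 * A₁ * (((∫ t : ℝ, ‖weilDodge τ h t‖) ^ 2 + (∫ t : ℝ, ‖deriv (weilDodge τ h) t‖) ^ 2)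
            + 2 * Real.exp a * (∫ t : ℝ, ‖iteratedDeriv (n + 1) (weilDodge τ h) t‖) ^ 2
                / R ^ (2 * n)) * Real.log (|γ₀| + 2)
        < 2 * ((riemannZetaZeroOrder (1 / 2 + η + γ₀ * I) : ℝ)
            * ((η ^ 2 + τ ^ 2) ^ 2 * ‖∫ t : ℝ, h t * cexp ((η : ℂ) * t)‖ ^ 2)) →
        weilGroundEnergy a < 0 := by
  obtain ⟨A₁, hA₁, hT⟩ := weilGroundEnergy_le_local_of_oddDipole
  refine ⟨A₁, hA₁, fun h a τ η γ₀ R n hh hodd ha hR hhs hpos hζ hη hη0 hγ hloc hwin ↦ ?_⟩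
  have key := hT h a τ η γ₀ R n hh hodd ha hR hhs hpos hζ hη hη0 hγ hloc
  exact key.trans_lt (div_neg_of_neg_of_pos (by linarith) hpos)

/-- **Exclusion form (T13′).** With the same `A₁`: if the window `[-a, a]` is Weil-positive
(`ε(a) ≥ 0` — true for every `a` under RH, and known unconditionally for small `a`) and local
RH of radius `R ≥ 1` holds near `γ₀` up to the pair `{½ ± η + iγ₀}`, then a zero `½ + η + iγ₀`
with `0 < |η| < ½`, `γ₀ ≠ 0` obeys, for EVERY odd Weil test `h` in `[-a, a]`, real `τ` with
`D_τ h ≠ 0`, and `n : ℕ`, the explicit constraint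
`2m(ρ₀)(η²+τ²)²|∫ h e^{ηt}|² ≤ 2A₁((‖k‖₁² + ‖k′‖₁²) + 2e^{a}‖k⁽ⁿ⁺¹⁾‖₁²/R^{2n}) log(|γ₀|+2)`. -/
theorem pair_gain_le_of_weilGroundEnergy_nonneg :
    ∃ A₁ : ℝ, 0 < A₁ ∧ ∀ (h : ℝ → ℂ) (a τ η γ₀ R : ℝ) (n : ℕ), IsWeilTest h →
      (∀ t, h (-t) = -h t) → 0 ≤ a → 1 ≤ R → tsupport h ⊆ Icc (-a) a →
      0 < ∫ t, ‖weilDodge τ h t‖ ^ 2 → riemannZeta (1 / 2 + η + γ₀ * I) = 0 → |η| < 1 / 2 →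
      η ≠ 0 → γ₀ ≠ 0 →
      (∀ ρ : ℂ, riemannZeta ρ = 0 → 0 ≤ ρ.re → ρ.re ≤ 1 → |ρ.im - γ₀| < R → ρ.re ≠ 1 / 2 →
          ρ = 1 / 2 + η + γ₀ * I ∨ ρ = 1 / 2 - η + γ₀ * I) →
      0 ≤ weilGroundEnergy a →
        2 * ((riemannZetaZeroOrder (1 / 2 + η + γ₀ * I) : ℝ)
            * ((η ^ 2 + τ ^ 2) ^ 2 * ‖∫ t : ℝ, h t * cexp ((η : ℂ) * t)‖ ^ 2))
          ≤ 2 * A₁ * (((∫ t : ℝ, ‖weilDodge τ h t‖) ^ 2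
                + (∫ t : ℝ, ‖deriv (weilDodge τ h) t‖) ^ 2)
              + 2 * Real.exp a * (∫ t : ℝ, ‖iteratedDeriv (n + 1) (weilDodge τ h) t‖) ^ 2
                  / R ^ (2 * n)) * Real.log (|γ₀| + 2) := by
  obtain ⟨A₁, hA₁, hT⟩ := weilGroundEnergy_neg_of_local_oddDipole
  refine ⟨A₁, hA₁, fun h a τ η γ₀ R n hh hodd ha hR hhs hpos hζ hη hη0 hγ hloc hε ↦ ?_⟩
  by_contra hlt
  exact absurd hε (not_le.mpr (hT h a τ η γ₀ R n hh hodd ha hR hhs hpos hζ hη hη0 hγ hloc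
    (not_le.mp hlt)))

end Summit.RiemannHypothesis.RiemannHypothesis.Theorems
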